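import Literature.MathematicalPhysics.QuantumFieldTheory.Volkov2020.PositiveDegreesBookkeeping
import HarnessLib

/-!
# Volkov 2020 (NPB 961, 115232) §3.3, the step (3.11) ⟹ (3.12)–(3.13): Lemma 3.9's factor `z′_{i₀}/max(z′_{i₀}, z_{i₀})` in Hepp-sector variables IS the monomial `∏_l t_l^{C_l}` with the printed `C_l` of (3.13) — PROVED (exact identity in the open sector), and (3.12) = (3.5) × (3.11) assembled as an inequality shape

independent recomputation; certified where stated, statistical where stated; no new-physics claim.

CITATION HEADER (venture `QEDPrecision`, cell `pub-qed`, track TROPICAL seat V3b = `pub-qed-trop-v3-lit-2` gen 12; VALUE-FREE: monomial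
bookkeeping in sector variables — no integrand, nothing per word). Companion of `Volkov2020.DenominatorSectorExponent` (B.28: the same
computation for Lemma 3.4's factor (z′_i)²/max(z′_i, z_i), whose `heppZ` / `zPath` / `mPos` / `iClos` / `suffix` vocabulary is used),
`Volkov2020.PositiveDegreesBookkeeping` (B.29: the case analysis of Theorem 3.1 on the exponents ⌈−ω⌉ + A′_l + B′_l + C′_l, with `cTerm` = C_l,
whose kernel-status table B.29.3 lists «(3.12): ✗»), `Volkov2020.ProjectorTreeExchange` (B.31/B.38: the right-hand side of (3.11) over D(z)) and
`Volkov2020.MomentumRouting` (B.40). Serves §B.41 of `tropical/view/V3-VOLKOV-DEGREES.md`.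

Source. [Volkov2020] S. Volkov, "Infrared and ultraviolet power counting on the mass shell in quantum electrodynamics", Nucl. Phys. B 961
(2020) 115232 = arXiv:1912.04885v4 (e-print tex `iclos_arxiv.tex`, sha256 8613757ca2360833…, held by the cell under
`pub-qed-trop-v3-lit-2/sources/arxiv-1912.04885/`; numbering by section = the journal's), VERBATIM:
* §3.1 (journal p.10; tex l.296–302): "z_{j₁} ≥ z_{j₂} ≥ … ≥ z_{j_L} … s^{[l]} = {j_l, j_{l+1}, …, j_L} … t₁ = z_{j₁}, t₂ = z_{j₂}/z_{j₁}, …,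
  t_L = z_{j_L}/z_{j_{L−1}}."
* Lemma 3.4 (journal p.12; tex l.369): "z′_i = max_{l∈LPath(i)} z_l".
* **Lemma 3.5, eq. (3.5)** (journal p.13; tex l.406–417): "|K(z)/W(z)^M| ≤ C ∏_{l=1}^{L} t_l^{⌈−ω(IClos(s^{[l]}))⌉+A_l+B_l}/(z_1…z_L)".
* **Lemma 3.9, eq. (3.11)** (journal p.16; tex l.525–531): "If |P| = 0, then … |Σ_{j:P_j=P} [𝒫Π_j] Y_j(z)| ≤ C · max_{i∈Ph(E(G))} z′_i/max(z′_i, z_i),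
  where C is some constant that depends only on the structure of the graph (and m), z′_i are defined in Lemma 3.4."
* **§3.3 after Lemma 3.9** (journal p.17; tex l.560–571): "Let us denote by i₀ the value of i on which the maximum (3.11) is reached. As a
  consequence of Lemma 3.9, we have the following inequality in terms of Lemma 3.5:
  |K(z)Σ_{j:P_j=P}[AΠ_j]Y_j(z)/W(z)^M| ≤ C · ∏_{l=1}^{L} t_l^{⌈−ω(IClos(s^{[l]}))⌉+A_l+B_l+C_l}/(z_1…z_L), (3.12) where
  C_l = 1, if |P| = 0 and i₀ ∈ IClos(s^{[l]})∖s^{[l]}, 0 in the other cases. (3.13)"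

READING (as in B.28: lines numbered by their position in the sector, line `k : Fin L` = Volkov's j_{k+1}, `z_k = t_0⋯t_k` = `heppZ t k`,
`s^{[l]}` ↦ `suffix L l`; a photon at position `i` with lepton path `lpath i` (positions), first path position `m_i = mPos`; `zPath` = z′_i).
The step (3.11) ⟹ (3.12) multiplies Lemma 3.5's bound by Lemma 3.9's and rewrites the factor `z′_{i₀}/max(z′_{i₀}, z_{i₀})` as a monomial in
the t's; this file computes that monomial and finds the printed exponents (3.13): in the sector z′_{i₀} = z_{m_{i₀}} (B.28 `zPath_eq`), so the
factor is 1 if m_{i₀} < i₀ and z_{m_{i₀}}/z_{i₀} = ∏_{i₀<k≤m_{i₀}} t_k otherwise, while «i₀ ∈ IClos(s^{[l]})∖s^{[l]}» unfolds to «i₀ ∉ s^{[l]}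
and LPath(i₀) ⊆ s^{[l]}», i.e. `i₀ < l ≤ m_{i₀}` in positions — the same indicator. Here the literal IClos(s)∖s is unambiguous (the B.28 caveat on
«Ph(IClos(s))» does not arise).

WHAT THE KERNEL CERTIFIES (all PROVED; Mathlib + B.28/B.29 only; no named fact, D-0026 net debt 0):
* §1 `ammFactor t lpath i` = z′_i/max(z′_i, z_i) in sector variables; `ammFactor_nonneg`, `ammFactor_le_one`; `cExp` = the DERIVED exponent
  `[i < k ≤ m_i]`; **`ammFactor_eq`: z′_i/max(z′_i, z_i) = ∏_k t_k^{[i<k≤m_i]}** (open sector 0 < t ≤ 1, nonempty path not containing i).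
* §2 `printedC` = **C_l of (3.13) AS PRINTED** per photon (case |P| = 0, i₀ = i); `printedC_eq` (= `[i < k ∧ k ≤ m_i]` in positions);
  `cExp_eq_printedC`; **`ammFactor_eq_prod_pow_printedC`: z′_{i₀}/max(z′_{i₀}, z_{i₀}) = ∏_k t_k^{C_k(i₀)} EXACTLY** — the identity behind «As a
  consequence of Lemma 3.9, we have (3.12) where C_l = (3.13)»; `cTerm_zero_eq_printedC` (the same C_l as B.29's `cTerm` at |P| = 0 with
  out = IClos(s^{[k]})∖s^{[k]}); `cTerm_eq_zero_of_pairs` (|P| ≥ 1: C_l = 0, consistent with `ammFactor_le_one` — nothing is claimed there).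
* §3 **`eq312_of_eq35_eq311`**: the assembly (3.5) × (3.11) ⟹ (3.12) as an inequality shape (|K/W^M| ≤ C₁F/D and |Σ[𝒫Π_j]Y_j| ≤ C₂Φ give
  |K·Σ/W^M| ≤ C₁C₂·FΦ/D), and `prod_zpow_mul_prod_pow` (the exponents add: ∏t^{d_l}·∏t^{C_l} = ∏t^{d_l+C_l}, integer d_l of either sign).
* §4 non-vacuity on the one-loop vertex graph in two sectors: `oneLoop_photonSmallest` (z_a ≥ z_b ≥ z_γ: every C_k = 0 and the factor is 1),
  `oneLoop_photonLargest` (z_γ ≥ z_a ≥ z_b: C = (0, 1, 0) and the factor is t_1 = z_a/z_γ).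
NOT claimed: (3.5) and (3.11) themselves as statements about the numbers K(z), W(z), [𝒫Π_j], Y_j(z) (their kernel pieces are B.27–B.31,
B.37–B.40: Lemma 3.3's bound, Lemma 3.4 on the circuit, the exchange core and coefficients of (3.11), Lemma 3.8; 𝒫 as a functional is not in the
tree), hence (3.12) as a statement about the integrand; the choice of i₀ as an argmax (any fixed photon i₀ gives the identity); anything per word.
-/

namespace Literature.MathematicalPhysics.QuantumFieldTheory.Volkov2020

open Finset

noncomputable section

variable {L : ℕ}

/-! ## §1 The factor of Lemma 3.9 in sector variables and its exact exponent -/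

/-- **Lemma 3.9's factor for the photon at position `i`**, in the sector variables of §3.1 (`heppZ`: z_k = t_0⋯t_k; `zPath` = z′_i AS PRINTED,
B.28): `z′_i / max(z′_i, z_i)` — the right-hand side of (3.11) at one photon. [cite: Volkov2020, Lemma 3.9 eq. (3.11) (journal p.16; arXiv:1912.04885v4 tex l.525–531)] -/
def ammFactor (t : Fin L → ℝ) (lpath : Fin L → Finset (Fin L)) (i : Fin L) : ℝ :=
  zPath t lpath i / max (zPath t lpath i) (heppZ t i)

/-- The EXACT exponent of `t_k` in `z′_i/max(z′_i, z_i)`: `[i < k ≤ m_i]`, `m_i` = the first position of LPath(i) (DERIVED; it will turn out to be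
the printed C_k of (3.13)). [cite: Volkov2020, §3.3 eq. (3.12)–(3.13) (journal p.17; arXiv:1912.04885v4 tex l.560–571) — exponent derived] -/
def cExp (lpath : Fin L → Finset (Fin L)) (i k : Fin L) : ℕ :=
  if i < k ∧ k ≤ mPos lpath i then 1 else 0

/-- A product of t_k to 0/1 exponents is the product over the selected positions. [cite: Volkov2020, Lemma 3.1 (journal p.11; tex l.304–315)] -/
private theorem prod_pow_ite {R : Type*} [CommMonoid R] (t : Fin L → R) (p : Fin L → Prop) [DecidablePred p] :
    ∏ k : Fin L, t k ^ (if p k then 1 else 0) = ∏ k ∈ univ.filter p, t k := by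
  rw [Finset.prod_filter]
  refine Finset.prod_congr rfl fun k _ => ?_
  split_ifs <;> simp

/-- `0 ≤ z′_i/max(z′_i, z_i)` for nonnegative `t`. [cite: Volkov2020, Lemma 3.9 eq. (3.11) (journal p.16; tex l.525–531)] -/
theorem ammFactor_nonneg (t : Fin L → ℝ) (ht0 : ∀ k, 0 ≤ t k) (lpath : Fin L → Finset (Fin L)) (i : Fin L) :
    0 ≤ ammFactor t lpath i := by
  unfold ammFactor
  have hz : 0 ≤ zPath t lpath i := by
    unfold zPath
    split_ifs with h
    · obtain ⟨l, hl⟩ := h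
      exact (heppZ_nonneg t ht0 l).trans (Finset.le_sup' (heppZ t) hl)
    · exact le_rfl
  exact div_nonneg hz (hz.trans (le_max_left _ _))

/-- `z′_i/max(z′_i, z_i) ≤ 1` (so the factor only ever LOWERS the bound; for `|P| ≥ 1`, where (3.13) puts `C_l = 0`, nothing is claimed).
[cite: Volkov2020, Lemma 3.9 eq. (3.11) (journal p.16; tex l.525–531)] -/
theorem ammFactor_le_one (t : Fin L → ℝ) (ht0 : ∀ k, 0 ≤ t k) (lpath : Fin L → Finset (Fin L)) (i : Fin L) :
    ammFactor t lpath i ≤ 1 := by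
  unfold ammFactor
  have hz : 0 ≤ zPath t lpath i := by
    unfold zPath
    split_ifs with h
    · obtain ⟨l, hl⟩ := h
      exact (heppZ_nonneg t ht0 l).trans (Finset.le_sup' (heppZ t) hl)
    · exact le_rfl
  rcases hz.eq_or_lt with h | h
  · rw [← h, zero_div]; exact zero_le_one
  · exact div_le_one_of_le₀ (le_max_left _ _) (h.le.trans (le_max_left _ _))

/-- **The exact sector form of Lemma 3.9's factor** (open sector `0 < t ≤ 1`; photon `i` not on its own nonempty lepton path):
`z′_i/max(z′_i, z_i) = ∏_k t_k^{[i < k ≤ m_i]}` — equal to `1` when the photon's parameter is below its whole path (`m_i < i`: then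
`max = z′_i`), and to `z_{m_i}/z_i = t_{i+1}⋯t_{m_i}` when `i < m_i` (`max = z_i`). [cite: Volkov2020, §3.3 «As a consequence of Lemma 3.9, we have … (3.12), where C_l = …  (3.13)» (journal p.17; arXiv:1912.04885v4 tex l.560–571)] -/
theorem ammFactor_eq (t : Fin L → ℝ) (ht : ∀ k, 0 < t k) (ht1 : ∀ k, t k ≤ 1) (lpath : Fin L → Finset (Fin L)) (i : Fin L)
    (hne : (lpath i).Nonempty) (hi : i ∉ lpath i) :
    ammFactor t lpath i = ∏ k : Fin L, t k ^ cExp lpath i k := by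
  have ht0 : ∀ k, 0 ≤ t k := fun k => (ht k).le
  have hzpos : ∀ k, 0 < heppZ t k := heppZ_pos t ht
  set m := mPos lpath i with hm
  have hmmem : m ∈ lpath i := by
    simp only [hm, mPos, dif_pos hne]; exact Finset.min'_mem _ hne
  have hmi : m ≠ i := fun h => hi (h ▸ hmmem)
  unfold ammFactor cExp
  rw [zPath_eq t ht0 ht1 lpath i hne, ← hm, prod_pow_ite]
  rcases lt_or_gt_of_ne hmi with hlt | hgt
  · -- m < i: max(z′, z_i) = z′ = z_m and no k has i < k ≤ m
    have hmax : max (heppZ t m) (heppZ t i) = heppZ t m := max_eq_left (heppZ_antitone t ht0 ht1 hlt.le)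
    have hempty : univ.filter (fun k : Fin L => i < k ∧ k ≤ m) = ∅ := by
      ext k
      simp only [Finset.mem_filter, Finset.mem_univ, true_and, Finset.notMem_empty, iff_false, not_and, not_le]
      intro hik
      exact hlt.trans hik
    rw [hmax, hempty, Finset.prod_empty, div_self (hzpos m).ne']
  · -- i < m: max(z′, z_i) = z_i and z_m = z_i · ∏_{i<k≤m} t_k
    have hmax : max (heppZ t m) (heppZ t i) = heppZ t i := max_eq_right (heppZ_antitone t ht0 ht1 hgt.le)
    have hsplit := heppZ_split t hgt.le
    have hfilt : univ.filter (fun k : Fin L => (i : ℕ) < k ∧ (k : ℕ) ≤ m) = univ.filter (fun k : Fin L => i < k ∧ k ≤ m) := by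
      ext k; simp
    rw [hfilt] at hsplit
    rw [hmax, hsplit, mul_comm, mul_div_assoc, div_self (hzpos i).ne', mul_one]

/-! ## §2 The printed `C_l` of (3.13) and the identification -/

/-- **C_l AS PRINTED, per photon** (for `|P| = 0`, `i₀ = i`), at the level `s^{[k]}` = `suffix L k`: `C_k(i) = 1` if `i ∈ IClos(s^{[k]}) ∖ s^{[k]}`,
`0` in the other cases (here IClos(s)∖s is unambiguous: a photon outside `s` lies in IClos(s) iff its lepton path lies in `s`).
[cite: Volkov2020, §3.3 eq. (3.13) (journal p.17; arXiv:1912.04885v4 tex l.565–571)] -/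
def printedC (Ph : Finset (Fin L)) (lpath : Fin L → Finset (Fin L)) (i : Fin L) (k : ℕ) : ℕ :=
  if i ∈ iClos Ph lpath (suffix L k) \ suffix L k then 1 else 0

/-- The printed C_k(i) unfolded in positions: `[i < k ∧ k ≤ m_i]` (`i ∉ s^{[k]}` ⟺ `i < k`; `LPath(i) ⊆ s^{[k]}` ⟺ `k ≤ m_i`).
[cite: Volkov2020, §3.3 eq. (3.13) with §2.1 I-closure and §3.1 s^{[l]} (journal p.17, p.7, p.10)] -/
theorem printedC_eq (Ph : Finset (Fin L)) (lpath : Fin L → Finset (Fin L)) {i : Fin L} (hiPh : i ∈ Ph)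
    (hne : (lpath i).Nonempty) (k : ℕ) :
    printedC Ph lpath i k = if (i : ℕ) < k ∧ k ≤ (mPos lpath i : ℕ) then 1 else 0 := by
  unfold printedC iClos
  have h2 : (i ∈ (suffix L k ∪ Ph.filter fun j => lpath j ⊆ suffix L k) \ suffix L k) ↔ ((i : ℕ) < k ∧ k ≤ (mPos lpath i : ℕ)) := by
    rw [Finset.mem_sdiff, Finset.mem_union, Finset.mem_filter, mem_suffix, lpath_subset_suffix_iff lpath i hne, not_le]
    constructor
    · rintro ⟨h | ⟨_, h⟩, hlt⟩
      · exact absurd h (not_le.2 hlt)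
      · exact ⟨hlt, h⟩
    · rintro ⟨hlt, h⟩
      exact ⟨Or.inr ⟨hiPh, h⟩, hlt⟩
  rw [if_congr h2 rfl rfl]

/-- **The derived exponent IS the printed C_l.** [cite: Volkov2020, §3.3 eq. (3.13) (journal p.17; arXiv:1912.04885v4 tex l.565–571)] -/
theorem cExp_eq_printedC (Ph : Finset (Fin L)) (lpath : Fin L → Finset (Fin L)) {i : Fin L} (hiPh : i ∈ Ph)
    (hne : (lpath i).Nonempty) (k : Fin L) : cExp lpath i k = printedC Ph lpath i k := by
  rw [printedC_eq Ph lpath hiPh hne]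
  unfold cExp
  simp only [Fin.lt_def, Fin.le_def]

/-- **(3.11) ⟹ (3.12)–(3.13): in every Hepp sector, Lemma 3.9's factor at the photon `i₀` is EXACTLY the monomial `∏_l t_l^{C_l}`** with the
printed `C_l` of (3.13) (case `|P| = 0`): `z′_{i₀}/max(z′_{i₀}, z_{i₀}) = ∏_k t_k^{C_k(i₀)}` for `0 < t ≤ 1`, `i₀ ∈ Ph(E(G))` with a nonempty lepton path
not containing it. [cite: Volkov2020, §3.3 «Let us denote by i₀ the value of i on which the maximum (3.11) is reached. As a consequence of Lemma 3.9, we have the following inequality … (3.12) where C_l = 1, if |P| = 0 and i₀ ∈ IClos(s^{[l]})∖s^{[l]}, 0 in the other cases (3.13)» (journal p.17; arXiv:1912.04885v4 tex l.560–571)] -/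
theorem ammFactor_eq_prod_pow_printedC (t : Fin L → ℝ) (ht : ∀ k, 0 < t k) (ht1 : ∀ k, t k ≤ 1) (Ph : Finset (Fin L))
    (lpath : Fin L → Finset (Fin L)) {i : Fin L} (hiPh : i ∈ Ph) (hne : (lpath i).Nonempty) (hi : i ∉ lpath i) :
    ammFactor t lpath i = ∏ k : Fin L, t k ^ printedC Ph lpath i k := by
  rw [ammFactor_eq t ht ht1 lpath i hne hi]
  exact Finset.prod_congr rfl fun k _ => by rw [cExp_eq_printedC Ph lpath hiPh hne k]

/-- The same `C_l` as `PositiveDegreesBookkeeping`'s `cTerm` (B.29) at `|P| = 0` with `out = IClos(s^{[k]}) ∖ s^{[k]}`.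
[cite: Volkov2020, §3.3 eq. (3.13) (journal p.17; arXiv:1912.04885v4 tex l.565–571)] -/
theorem cTerm_zero_eq_printedC (Ph : Finset (Fin L)) (lpath : Fin L → Finset (Fin L)) (i : Fin L) (k : ℕ) :
    PositiveDegrees.cTerm 0 i (iClos Ph lpath (suffix L k) \ suffix L k) = (printedC Ph lpath i k : ℚ) := by
  unfold PositiveDegrees.cTerm printedC
  by_cases h : i ∈ iClos Ph lpath (suffix L k) \ suffix L k
  · rw [if_pos ⟨rfl, h⟩, if_pos h]; norm_num
  · rw [if_neg (fun h' => h h'.2), if_neg h]; norm_num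

/-- For `|P| ≥ 1` the printed C_l vanishes (B.29's `cTerm` with `pcard ≠ 0`), consistent with `ammFactor_le_one`: no factor is claimed there.
[cite: Volkov2020, §3.3 eq. (3.13) «0 in the other cases» (journal p.17; arXiv:1912.04885v4 tex l.565–571)] -/
theorem cTerm_eq_zero_of_pairs {ι : Type*} [DecidableEq ι] {pcard : ℕ} (hp : pcard ≠ 0) (i0 : ι) (out : Finset ι) :
    PositiveDegrees.cTerm pcard i0 out = 0 := by
  unfold PositiveDegrees.cTerm
  rw [if_neg (fun h => hp h.1)]

/-! ## §3 (3.12) = (3.5) × (3.11): the assembly as an inequality shape -/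

/-- **(3.5) × (3.11) ⟹ (3.12).** If `|K/W^M| ≤ C₁·F/(z_1⋯z_L)` (Lemma 3.5, eq. (3.5), `F = ∏ t_l^{⌈−ω(IClos(s^{[l]}))⌉+A_l+B_l}`) and
`|Σ_{j:P_j=P}[𝒫Π_j]Y_j| ≤ C₂·Φ` (Lemma 3.9, eq. (3.11), `Φ = max_i z′_i/max(z′_i, z_i) = z′_{i₀}/max(z′_{i₀}, z_{i₀})`), then
`|K·Σ[𝒫Π_j]Y_j/W^M| ≤ (C₁C₂)·(F·Φ)/(z_1⋯z_L)` — and `F·Φ = ∏ t_l^{⌈−ω⌉+A_l+B_l+C_l}` by `ammFactor_eq_prod_pow_printedC`.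
[cite: Volkov2020, §3.3 eq. (3.12) (journal p.17; arXiv:1912.04885v4 tex l.560–564)] -/
theorem eq312_of_eq35_eq311 {KW S C₁ C₂ F Φ D : ℝ} (hD : 0 < D) (hC₁ : 0 ≤ C₁) (hF : 0 ≤ F)
    (h35 : |KW| ≤ C₁ * F / D) (h311 : |S| ≤ C₂ * Φ) :
    |KW * S| ≤ C₁ * C₂ * (F * Φ) / D := by
  rw [abs_mul]
  have h1 : 0 ≤ C₁ * F / D := div_nonneg (mul_nonneg hC₁ hF) hD.le
  calc |KW| * |S| ≤ C₁ * F / D * (C₂ * Φ) := mul_le_mul h35 h311 (abs_nonneg S) h1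
    _ = C₁ * C₂ * (F * Φ) / D := by ring

/-- The exponents add: `(∏_k t_k^{d_k}) · (∏_k t_k^{C_k}) = ∏_k t_k^{d_k + C_k}` for integer `d_k` (the exponents of (3.5) may be of either
sign) and positive `t`. [cite: Volkov2020, §3.3 eq. (3.12) (journal p.17; arXiv:1912.04885v4 tex l.560–564)] -/
theorem prod_zpow_mul_prod_pow (t : Fin L → ℝ) (ht : ∀ k, 0 < t k) (d : Fin L → ℤ) (C : Fin L → ℕ) :
    (∏ k : Fin L, t k ^ d k) * ∏ k : Fin L, t k ^ C k = ∏ k : Fin L, t k ^ (d k + C k) := by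
  rw [← Finset.prod_mul_distrib]
  refine Finset.prod_congr rfl fun k _ => ?_
  rw [zpow_add₀ (ht k).ne', zpow_natCast]

/-! ## §4 Non-vacuity: the one-loop vertex graph in two sectors -/

/-- One-loop graph, sector `z_a ≥ z_b ≥ z_γ` (positions a = 0, b = 1, γ = 2; LPath(γ) = {0, 1}): `m_γ = 0 < 2`, the factor is `1` and every
`C_k(γ) = 0` — in this sector Lemma 3.9 contributes no power of `t`. [cite: Volkov2020, §3.3 eq. (3.12)–(3.13) (journal p.17; tex l.560–571)] -/
theorem oneLoop_photonSmallest (t : Fin 3 → ℝ) (ht : ∀ k, 0 < t k) (ht1 : ∀ k, t k ≤ 1) :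
    let lpath : Fin 3 → Finset (Fin 3) := fun _ => {0, 1}
    (∀ k : Fin 3, printedC ({2} : Finset (Fin 3)) lpath 2 k = 0) ∧ ammFactor t lpath 2 = 1 := by
  intro lpath
  have hC : ∀ k : Fin 3, printedC ({2} : Finset (Fin 3)) lpath 2 k = 0 := by decide
  refine ⟨hC, ?_⟩
  rw [ammFactor_eq_prod_pow_printedC t ht ht1 {2} lpath (by decide) ⟨0, by decide⟩ (by decide)]
  simp [hC]

/-- One-loop graph, sector `z_γ ≥ z_a ≥ z_b` (positions γ = 0, a = 1, b = 2; LPath(γ) = {1, 2}): `m_γ = 1 > 0`, `C_1(γ) = 1`, `C_0 = C_2 = 0`,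
and the factor is `z′_γ/z_γ = t_1`. [cite: Volkov2020, §3.3 eq. (3.12)–(3.13) (journal p.17; tex l.560–571)] -/
theorem oneLoop_photonLargest (t : Fin 3 → ℝ) (ht : ∀ k, 0 < t k) (ht1 : ∀ k, t k ≤ 1) :
    let lpath : Fin 3 → Finset (Fin 3) := fun _ => {1, 2}
    printedC ({0} : Finset (Fin 3)) lpath 0 0 = 0 ∧ printedC ({0} : Finset (Fin 3)) lpath 0 1 = 1 ∧
      printedC ({0} : Finset (Fin 3)) lpath 0 2 = 0 ∧ ammFactor t lpath 0 = t 1 := by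
  intro lpath
  have h0 : printedC ({0} : Finset (Fin 3)) lpath 0 0 = 0 := by decide
  have h1 : printedC ({0} : Finset (Fin 3)) lpath 0 1 = 1 := by decide
  have h2 : printedC ({0} : Finset (Fin 3)) lpath 0 2 = 0 := by decide
  refine ⟨h0, h1, h2, ?_⟩
  rw [ammFactor_eq_prod_pow_printedC t ht ht1 {0} lpath (by decide) ⟨1, by decide⟩ (by decide)]
  rw [Fin.prod_univ_three]
  have h1' : printedC ({0} : Finset (Fin 3)) lpath 0 ((1 : Fin 3) : ℕ) = 1 := h1
  have h2' : printedC ({0} : Finset (Fin 3)) lpath 0 ((2 : Fin 3) : ℕ) = 0 := h2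
  have h0' : printedC ({0} : Finset (Fin 3)) lpath 0 ((0 : Fin 3) : ℕ) = 0 := h0
  rw [h0', h1', h2']
  simp

end

end Literature.MathematicalPhysics.QuantumFieldTheory.Volkov2020
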